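import Mathlib
import Summits.PneNP.PneNP.Theses.OneSlice
import Summits.PneNP.PneNP.Theorems.OneSliceSliceTargetSplit

/-!
# Route OneSlice, crux `MonotoneContinuation` (stmt-PneNP-18471), line `Sketch_ideator1_r1` (ProfileLine) — stub levelAverage

FLAT LEVEL AVERAGES OF THE TRANSPORT. For `i, j ≤ N = C(n,2)` and any real `g` on the edge cube, summing the
slice-`j` transport `T_j g` (`transport j g y = (Σ_{x ∈ nbhd j y} g x) / #(nbhd j y)`) over the level `slice n i`
gives `#slice_i ·` (the slice-`j` average of `g`):
`Σ_{y ∈ slice i} T_j g y = #slice_i · (Σ_{x ∈ slice j} g x) / #slice_j`.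
Proof: double counting. On slice `i` the denominator `#(nbhd j y) = D(N,i,j)` is constant (`card_nbhd`), so
`Σ_{y ∈ slice i} T_j g y = (Σ_{y ∈ slice i} Σ_{x ∈ nbhd j y} g x) / D(N,i,j) = D(N,j,i)·(Σ_{x ∈ slice j} g x) / D(N,i,j)`
(`sum_slice_sum_nbhd_left`), and the reciprocity `C(N,i)·D(N,i,j) = C(N,j)·D(N,j,i)` (`choose_mul_nbhdCard`)
together with `#slice_i = C(N,i)` (`card_slice`) and `D(N,i,j) > 0` for `i, j ≤ N` (`nbhdCard_pos`) finishes.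
(The `≤` half without the hypotheses `i, j ≤ N` is the `hslice` step of `sum_gnpWeight_transport_le`.)
-/

set_option linter.dupNamespace false -- `Summit.PneNP.PneNP.…`: summit = sub-problem (D-0017)

namespace Summit.PneNP.PneNP.Theorems.MonotoneContinuation

open Literature.Computability.Complexity hiding supp mem_supp
open Finset hiding slice
open Filter hiding mem_sdiff
open Classical
open Summit.PneNP.PneNP.Theorems (binomialWeight_tail_le binomialWeight_sum_range binomialWeight_nonneg
  binomialWeight_variance card_slice)
open Summit.PneNP.PneNP.Theorems.ConstantBand.Negative (Edge thr Central slice)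
open Summit.PneNP.PneNP.Theorems.SingleThreshold.Negative (pc)
open Summit.PneNP.PneNP.Theorems.SliceACZero.Negative (supp mem_supp card_supp supp_injective supp_indicator)
open Summit.PneNP.PneNP.Theorems.SliceTargetSplit (Comp nbhd mem_nbhd transport ind l1 nbhdCard card_nbhd
  card_nbhd_of_le card_nbhd_of_ge choose_mul_nbhdCard nbhdCard_pos sum_slice_sum_nbhd sum_slice_sum_nbhd_left
  supp_subset_of_comp_of_le comp_iff_supp comp_comm ofSet supp_ofSet ofSet_supp edgeCount_ofSet ind_nonneg
  ind_le_one abs_ind_sub_ind l1_triangle l1_comm l1_nonneg transport_nonneg transport_sub)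

noncomputable section

variable {n : ℕ}

/-- **Flat level averages of the transport.** For `i, j ≤ C(n,2)` and every real `g` on the edge cube of `K_n`,
the sum of the slice-`j` transport `T_j g` over the Hamming slice `i` equals `#slice_i` times the slice-`j` average
of `g`: `Σ_{y ∈ slice i} T_j g y = #slice_i · (Σ_{x ∈ slice j} g x) / #slice_j` (double counting of comparable pairs
between the slices `i` and `j`, plus the reciprocity `C(N,i)·D(N,i,j) = C(N,j)·D(N,j,i)`). [folklore] -/
theorem stub_levelAverage :
  ∀ (n i j : ℕ) (g : (Edge n → Bool) → ℝ), i ≤ n.choose 2 → j ≤ n.choose 2 →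
    ∑ y ∈ slice n i, transport j g y = (#(slice n i) : ℝ) * ((∑ x ∈ slice n j, g x) / #(slice n j)) := by
  intro n i j g hi hj
  -- on slice `i` the denominator of the transport is the constant `D(N,i,j)`
  have hT : ∑ y ∈ slice n i, transport j g y =
      (∑ y ∈ slice n i, ∑ x ∈ nbhd j y, g x) / (nbhdCard (n.choose 2) i j : ℝ) := by
    rw [sum_div]
    refine sum_congr rfl fun y hy => ?_
    rw [transport, card_nbhd (mem_filter.1 hy).2]
  rw [hT, sum_slice_sum_nbhd_left i j g, card_slice, card_slice]
  -- positivity of the denominators inside the cube, and reciprocity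
  have hD : (0 : ℝ) < nbhdCard (n.choose 2) i j := by exact_mod_cast nbhdCard_pos hi hj
  have hCj : (0 : ℝ) < (n.choose 2).choose j := by exact_mod_cast Nat.choose_pos hj
  have hrec : ((n.choose 2).choose i : ℝ) * nbhdCard (n.choose 2) i j =
      (n.choose 2).choose j * nbhdCard (n.choose 2) j i := by
    exact_mod_cast choose_mul_nbhdCard (n.choose 2) i j
  have key : ((n.choose 2).choose i : ℝ) / (n.choose 2).choose j =
      nbhdCard (n.choose 2) j i / nbhdCard (n.choose 2) i j := by
    rw [div_eq_div_iff hCj.ne' hD.ne', hrec, mul_comm]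
  generalize (∑ x ∈ slice n j, g x) = S
  calc (nbhdCard (n.choose 2) j i : ℝ) * S / nbhdCard (n.choose 2) i j
      = nbhdCard (n.choose 2) j i / nbhdCard (n.choose 2) i j * S := by ring
    _ = ((n.choose 2).choose i : ℝ) / (n.choose 2).choose j * S := by rw [key]
    _ = ((n.choose 2).choose i : ℝ) * (S / (n.choose 2).choose j) := by ring

end

end Summit.PneNP.PneNP.Theorems.MonotoneContinuation
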